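import Summits.QuantumFields.YangMills.Theorems.SqueezedSkewnessTorusKLStubTorusMixtureData
import HarnessLib

/-!
# Route `SqueezedSkewness`, node `PointlikeHypercubeFloorsB` (stmt-QuantumFields-23719): the registered stub `stub_torusKL`
# BY NAME AND SIGNATURE (port of the closed crux `TorusKL`, stmt-QuantumFields-23204)

Registry hygiene for the skeleton `Cruxes/NT/Lines/pointlike_nodeB_birth.lean` (planner ym-idea-6 g12): its stub
`stub_torusKL : __Registered.stub_torusKL` (`= Theses.SqueezedSkewness.TorusKL` by name) is the crux `TorusKL`, CLOSED·proved by
`Theorems.TorusKL.TorusKL_proof` (keyed prover `ym-line-fcl-p3` g16, p677363).  This file lands the stub by name so that LINE χ's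
composition `PointlikeHypercubeFloorsB_of (stub_femtoFloorUnit) (stub_torusKL)` — like LINE χ₄'s `PointlikeHypercubeFloorsB_of_rp`
after stubs A/B/7 (p678403, p677248) — reads «needs only `FemtoFloorUnit`» in the registry.  Width seat `ym-line-sfw-p2-w4` g19
(cell ym-idea-1; free hands), `--supports stmt-QuantumFields-23719`.  HONEST FRAMING: nothing new is proved here; no NT statement,
rung or summit; the YM mass gap is NOT proved. [folklore]
-/

set_option autoImplicit false

namespace Summit.QuantumFields.YangMills.Theorems.SqueezedSkewnessPointlikeNodeBTorusKLPort

/-! ## Name-keyed statement (verbatim from the skeleton) -/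
namespace __Registered

/-- Registered name-keyed statement: `= SqueezedSkewness.TorusKL` (stmt-QuantumFields-23204, crux r5) BY NAME — verbatim the
skeleton's `__Registered.stub_torusKL` (a problem-side abbreviation, not a literature fact). -/
abbrev stub_torusKL : Prop := Summit.QuantumFields.YangMills.Theses.SqueezedSkewness.TorusKL

end __Registered

/-- **Registered stub `stub_torusKL` of node 23719, BY NAME AND SIGNATURE**: the closed crux `TorusKL` (p677363). [folklore] -/
theorem stub_torusKL : __Registered.stub_torusKL :=
  Summit.QuantumFields.YangMills.Theorems.TorusKL.TorusKL_proof

end Summit.QuantumFields.YangMills.Theorems.SqueezedSkewnessPointlikeNodeBTorusKLPort
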